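import Literature.NumberTheory.DiophantineGeometry.MordellThueRamanujanNagellHeightBounds
import Literature.NumberTheory.EllipticCurves.SilvermanHeightLogDiscriminant
import Literature.NumberTheory.EllipticCurves.Isogeny
import Literature.NumberTheory.DiophantineGeometry.MinimalDiscriminant
import HarnessLib

/-!
# The elliptic curves attached to solutions of Mordell and `S`-unit (`abc`) equations
# (von Känel–Matschke 2016/2023, Lemmas 10.3, 10.4, 10.5 and the table (10.x))

Topic `Literature/NumberTheory/EllipticCurves` (family `abc`; the *modular method*). The "effective Paršin
constructions" `φ : Y(𝒪) → M(T)` behind the height bounds of von Känel–Matschke, arXiv:1605.06079 (Feb. 2016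
version, held TeX text) = Mem. AMS **286** (2023) no. 1419 [`VonkanelMatschke2023`], §10.3–§10.4 (arXiv
numbering): a solution of a Mordell equation, resp. of the `abc`-equation (10.x) `eq:abc`, gives an elliptic
curve over `ℚ` with controlled conductor and minimal discriminant and with the Weil height of the solution
bounded by the Faltings height of the curve. Combined with the height–conductor and discriminant–conductor
inequalities of `HeightConductorBoundsModularity.lean` (vKM Prop. 10.8, (10.x) `eq:szpiro`) these are exactly
the printed proofs of Props. 10.1, 10.2, 10.6 (`SUnitMordellHeightBoundsModularity.lean`).

* **Lemma 10.3** (`lem:pm2`; Mordell equation `y² = x³ + a`, `(x, y) ∈ 𝒪 × 𝒪`, `0 ≠ a ∈ 𝒪 = ℤ[1/N_S]`):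
  an elliptic curve `E/ℚ` with `c₄ = u⁴x`, `c₆ = u⁶y` for some `u ∈ ℚ` with `u¹² = 1728 Δ_E |a|⁻¹`, `N_E ∣ a_S`,
  and `max(h(x), (2/3)h(y)) ≤ (1/3)h(a) + 8h(E) + 2 log max(1, h(E)) + 36`.
* **Lemma 10.4** (`lem:pm3`; `(x, y) ∈ ℤ × ℤ` primitive): in addition `Δ_E = 2^m 3^n |a|`, `m ∈ {−6, 6}`,
  `n ∈ {−3, 9}`; `E` semistable at each `p ≥ 5` with `gcd(x, y, p) = 1`;
  `max(h(x), (2/3)h(y)) ≤ 4h(E) + 2 log max(1, h(E)) + 28`.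
* **Lemma 10.5** (`lem:psu2`; `(a, b, c)` a solution of (10.x) `eq:abc`: `a + b = c`, `abc ≠ 0`,
  `gcd(a, b, c) = 1`, `rad(abc) ∣ N_S`) with the remark (10.x) `eq:refinedcondbound` after its proof:
  `ℚ`-isogenous elliptic curves `E, E'` (Frey–Hellegouarch curves `y² = x(x − A)(x + B)` in the normalisation
  `A ≡ −1 (4)`, `B` even, and the `2`-isogenous `w² = z³ − 2(β − α)z² + γ²z`) with `N_E ∣ 2⁴ N_S`,
  `ord₂(N_E) = 𝔢 + 1`, `Δ_E = 2^n (abc)²`, `n ∈ {4, −8}`, and `Δ_{E'} = 2^{8−12m} |ab| c⁴`, `m ∈ {0, 1, 2, 3}`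
  (Diamond–Kramer; compare the tree's `conductorNorm_freyCurve_dvd`, `conductorNorm_freyCurve_of_mod`,
  `minimalDiscriminantNorm_freyCurve_of_mod` for the un-normalised / Serre-normalised Frey curve).

## Dictionary

As in `HeightConductorBoundsModularity.lean`: `E/ℚ` = `W : WeierstrassCurve ℚ` with `W.IsElliptic`; "minimal
Weierstrass equation over `ℤ`" (vKM §10.2: `c₄, c₆` "associated to a minimal Weierstrass equation of `E`
over `ℤ`") = `W.IsGloballyMinimal`, so `c₄ = W.c₄`, `c₆ = W.c₆`, `Δ_E = |W.Δ| = W.minimalDiscriminantNorm ℤ`;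
`N_E = W.conductorNorm ℤ`; `h(E)` (Faltings' normalisation) = `neronLatticeHeight L` for any period pair `L`
with `IsNeronLatticeOf (W.baseChange ℂ) L`; `ℚ`-isogeny = `WeierstrassCurve.IsIsogenous`; a rational prime
`p` is the finite place `v : HeightOneSpectrum ℤ` with `Ideal.absNorm v.asIdeal = p`. Diophantine side:
`primesProd = N_S`, `IsSInteger`, `mordellLevel = a_S`, `refinedExp = 𝔢`, `IsPrimitivePair`,
`h = Height.logHeight₁`.

Named facts (`def … : Prop`, D-0014), nothing discharged; no `abc` claim; typed ≠ proved.
-/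

noncomputable section

open Height WeierstrassCurve IsDedekindDomain
open Literature.NumberTheory.DiophantineGeometry.VonKanelMatschke

namespace Literature.NumberTheory.EllipticCurves.ModularForms

/-- **vKM Lemma 10.3** (`lem:pm2`): *"Suppose that `(x, y)` satisfies the Mordell equation (1.2). Then there
exists an elliptic curve `E` over `ℚ` with the following properties. It holds that `c₄ = u⁴x` and `c₆ = u⁶y`
for some `u ∈ ℚ` with `u¹² = 1728 Δ_E |a|⁻¹`, the conductor `N_E` divides `a_S` and
`max(h(x), (2/3)h(y)) ≤ (1/3)h(a) + 8h(E) + 2 log max(1, h(E)) + 36`."* (`E` is `t² = s³ − 27xs − 54y`; the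
conductor refinement `N_E ∣ a_S`, rather than `∣ 2²3² a_S` of [vK 2014], by Tate's algorithm at `2, 3`.)
Rendered with `E` a globally minimal model `W` (so `c₄, c₆, Δ_E` are those of a minimal equation over `ℤ`).
[cite: VonkanelMatschke2023, Lemma 10.3 (arXiv §10.3, lem:pm2)] -/
def vonKanelMatschke_lemma_10_3 : Prop :=
  ∀ (S : Finset ℕ), (∀ p ∈ S, p.Prime) → ∀ a : ℚ, a ≠ 0 → IsSInteger S a →
    ∀ x y : ℚ, IsSInteger S x → IsSInteger S y → y ^ 2 = x ^ 3 + a →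
      ∃ (W : WeierstrassCurve ℚ) (_ : W.IsElliptic) (_ : W.IsGloballyMinimal) (u : ℚ),
        W.c₄ = u ^ 4 * x ∧ W.c₆ = u ^ 6 * y ∧
        u ^ 12 = 1728 * (W.minimalDiscriminantNorm ℤ : ℚ) * |a|⁻¹ ∧
        W.conductorNorm ℤ ∣ mordellLevel S a ∧
        ∀ L : PeriodPair, IsNeronLatticeOf (W.baseChange ℂ) L →
          max (logHeight₁ x) (2 / 3 * logHeight₁ y) ≤
            1 / 3 * logHeight₁ a + 8 * neronLatticeHeight L +
              2 * Real.log (max 1 (neronLatticeHeight L)) + 36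

/-- **vKM Lemma 10.4** (`lem:pm3`): *"Suppose that `(x, y) ∈ ℤ × ℤ` is a primitive solution of (1.2). If
Lemma 10.3 associates `(x, y)` to the elliptic curve `E`, then `E` has in addition the following properties.
(i) It holds that `Δ_E = 2^m 3^n |a|` with `m ∈ {−6, 6}` and `n ∈ {−3, 9}`. (ii) The curve `E` is semi-stable
at each rational prime `p ≥ 5` with `gcd(x, y, p) = 1`. (iii) There is the refined height inequality
`max(h(x), (2/3)h(y)) ≤ 4h(E) + 2 log max(1, h(E)) + 28`."* Rendered as the existence of `E = W` with the
properties of Lemma 10.3 and (i)–(iii) (`a = y² − x³ ∈ ℤ ∖ {0}`, `S` any finite set of primes with `a ∈ 𝒪`,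
automatically true). [cite: VonkanelMatschke2023, Lemma 10.4 (arXiv §10.3, lem:pm3)] -/
def vonKanelMatschke_lemma_10_4 : Prop :=
  ∀ (S : Finset ℕ), (∀ p ∈ S, p.Prime) → ∀ a : ℤ, a ≠ 0 →
    ∀ x y : ℤ, IsPrimitivePair x y → y ^ 2 = x ^ 3 + a →
      ∃ (W : WeierstrassCurve ℚ) (_ : W.IsElliptic) (_ : W.IsGloballyMinimal) (u : ℚ),
        W.c₄ = u ^ 4 * x ∧ W.c₆ = u ^ 6 * y ∧
        u ^ 12 = 1728 * (W.minimalDiscriminantNorm ℤ : ℚ) * |(a : ℚ)|⁻¹ ∧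
        W.conductorNorm ℤ ∣ mordellLevel S a ∧
        (∃ m ∈ ({-6, 6} : Finset ℤ), ∃ n ∈ ({-3, 9} : Finset ℤ),
          (W.minimalDiscriminantNorm ℤ : ℚ) = (2 : ℚ) ^ m * (3 : ℚ) ^ n * |(a : ℚ)|) ∧
        (∀ v : HeightOneSpectrum ℤ, 5 ≤ Ideal.absNorm v.asIdeal →
          ¬ ((Ideal.absNorm v.asIdeal : ℤ) ∣ x ∧ (Ideal.absNorm v.asIdeal : ℤ) ∣ y) → W.IsSemistableAt v) ∧
        ∀ L : PeriodPair, IsNeronLatticeOf (W.baseChange ℂ) L →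
          max (logHeight₁ (x : ℚ)) (2 / 3 * logHeight₁ (y : ℚ)) ≤
            4 * neronLatticeHeight L + 2 * Real.log (max 1 (neronLatticeHeight L)) + 28

/-- **vKM Lemma 10.5** (`lem:psu2`) **with the remark (10.x) `eq:refinedcondbound`**: *"Suppose that
`(a, b, c)` is a solution of (eq:abc) [`a + b = c`, `a, b, c ∈ ℤ ∖ {0}`, `gcd(a, b, c) = 1`, `rad(abc) ∣ N_S`].
Then there exist `ℚ`-isogenous elliptic curves `E` and `E'` over `ℚ` such that `N_E` divides `2⁴N_S`,
`Δ_E = 2^n (abc)²` with `n ∈ {4, −8}`, and `Δ_{E'} = 2^{8−12m} |ab| c⁴` with `m ∈ {0, 1, 2, 3}`"*; and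
*"If Lemma 10.5 associates `(a, b, c)` to the elliptic curve `E` over `ℚ`, then the conductor `N_E` of `E`
satisfies `ord₂(N_E) = 𝔢 + 1`"* with `𝔢 = 𝔢(ord₂(abc))` from the table (`refinedExp`). (Proof in print:
explicit Frey–Hellegouarch curves and a formula of Diamond–Kramer.) `Δ` denotes the (positive) minimal
discriminant `minimalDiscriminantNorm`; `2^{8−12m} |ab| c⁴ = Δ_{E'}` is written `2^{12m} Δ_{E'} = 2⁸ |ab| c⁴`.
[cite: VonkanelMatschke2023, Lemma 10.5 (arXiv §10.4, lem:psu2) with (eq:refinedcondbound)] -/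
def vonKanelMatschke_lemma_10_5 : Prop :=
  ∀ (S : Finset ℕ), (∀ p ∈ S, p.Prime) → ∀ a b c : ℤ, a ≠ 0 → b ≠ 0 → c ≠ 0 → a + b = c →
    Int.gcd (Int.gcd a b : ℤ) c = 1 →
    UniqueFactorizationMonoid.radical (a * b * c).natAbs ∣ primesProd S →
      ∃ (W W' : WeierstrassCurve ℚ) (_ : W.IsElliptic) (_ : W'.IsElliptic),
        W.IsIsogenous W' ∧
        W.conductorNorm ℤ ∣ 2 ^ 4 * primesProd S ∧
        (padicValNat 2 (W.conductorNorm ℤ) : ℤ) = refinedExp (padicValNat 2 (a * b * c).natAbs) + 1 ∧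
        (W.minimalDiscriminantNorm ℤ = 2 ^ 4 * (a * b * c).natAbs ^ 2 ∨
          2 ^ 8 * W.minimalDiscriminantNorm ℤ = (a * b * c).natAbs ^ 2) ∧
        ∃ m : ℕ, m ≤ 3 ∧ 2 ^ (12 * m) * W'.minimalDiscriminantNorm ℤ = 2 ^ 8 * (a * b).natAbs * c.natAbs ^ 4

end Literature.NumberTheory.EllipticCurves.ModularForms

end
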